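import Summits.BirchSwinnertonDyer.BirchSwinnertonDyer.Theorems.PrintX11aLowerHalfOfChildrenMuFive
import Summits.BirchSwinnertonDyer.Rank1Residual.X11a.MainConjectureHeightFree
import HarnessLib

/-!
# Crux `X11aLowerHalf` (item stmt-BirchSwinnertonDyer-19064): the `p ≥ 5` child in MAZUR currency — candidate r17
# (lead bsd-line-x11a-p1 g7; `--supports stmt-BirchSwinnertonDyer-19064` helper; composition + monotonicity theorems only)

HONEST FRAMING.  Theorems only; no definition, no named fact minted, no `sorry`.  Every theorem is CONDITIONAL on the binders it
displays and closes nothing by itself; the two residual statements of the line (`hMC5` at `p ≥ 5`, `hMC3` at `p = 3` très ramifié)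
are OPEN research statements, displayed, never asserted.  No summit statement is proved; BSD is proved for no curve and no class.

WHY THIS FILE.  The registered line «birth» r16 of crux L (skeleton 06fb1f5303c8e9dd, five stubs) types its `p ≥ 5` child as
Greenberg's ANALYTIC `μ = 0` on the deep X11a locus (`stub_muAnDeepFive : ∀ W p, ClassX11a W p → 5 ≤ p → ¬ X11a.ShaAnUnit W p →
X11a.MuAnZeroAt W p`, Conj. 1.11) and routes it to the lower half through X. Wan's rational Thm. 4 at an ordinary member of `H(E[p])`,
Emerton–Pollack–Weston 3.1.1 ∕ Thm. 1 ∕ 5.1.3, Deligne–Serre 6.1, Hida 3.26 and Kato–Wuthrich A32 (the chain-EIGHT stub), whereas its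
`p = 3` très-ramifié child is typed (r15) in MAZUR currency (`X2.MazurMainConjectureAt W 3`) and routed through the FIVE-fact door
`ClassX11a.missingLowerBoundAt_of_mazurMainConjectureAt_of_facts` (p646859 §1) — a door stated for ANY X11a pair.  This file cuts the
`p ≥ 5` child in the SAME currency:

* §1 `ClassX11a.mazurMainConjectureAt_of_member_of_ratEq_of_multDivisibilityAt` — PER PAIR, any odd `p`, either image: the typed
  divisibility `X11b.MultDivisibilityAt W p`, the certificate `μ^an(E,p) = 0`, ONE good-ordinary member with the rational equality and
  the odd-prime EPW facts ⟹ Mazur's statement at the pair (the first two steps of the tree door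
  `ClassX11a.missingLowerBoundAt_of_member_of_ratEq_of_multDivisibilityAt`, exposed at the hinge `X2.MazurMainConjectureAt`);
* §2 MONOTONICITY `Birth.mazurMCAtDeepFive_of_muAnDeepFive_of_facts` — r16's `p ≥ 5` text + the shared nine + SEVEN of r16's eight chain
  facts ⟹ the r17 text `∀ W p, ClassX11a W p → 5 ≤ p → ¬ X11a.ShaAnUnit W p → X2.MazurMainConjectureAt W p` (surjective image: Serre's
  `p`-adic surjectivity + A32; non-surjective: the `_contra` packages + Kato 12.4 + Mazur 4.1; Wan's member at `p ≥ 5`).  So the re-cut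
  is MONOTONE: every proof of the r16 text closes the r17 text modulo facts r16 already displayed, and every per-pair `μ`-certificate
  still yields Mazur's statement at its pair;
* §3 the five-children composition `Birth.x11aLowerHalf_of_children_r17 h9 h2L hQ3 hMC5 hMC3` — crux L BY NAME: unit pairs free; `p ≥ 5`
  deep ⟵ `hMC5` through the five-fact door (modularity, Stein–Wuthrich 6.1 ×2, GZK, Greenberg–Stevens AT THE PAIR; NO chain fact);
  `p = 3` deep verbatim r15∕r16 (`ThreePartner.lowerThreeDeep_of_partnerFF_of_mazurTR_of_facts`: finite flat ⟶ the Hesse-pencil partner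
  + the THREE-fact partner road with Kato–Wuthrich A32 and GZK; très ramifié ⟶ `hMC3`).  `h2L` = the TWO chain facts still consumed
  (A32, GZK); distinct named published facts on such a line: 14 (r16: 20);
* §4 bookkeeping: r16's chain-eight ⟹ the seven ∕ the two (projections `chainSeven_of_chainEight`, `chainTwo_of_chainEight`), so
  r16's five binders give the crux through r17 (cross-check recorded as a comment; its statement is p652061's, not re-landed);
* §5 `mazurMCAtSurjFive_iff_lowerSurjFive_of_facts`: on the SURJECTIVE locus at `p ≥ 5` the r17 child is EQUIVALENT to the crux
  restricted there modulo A32, Stein–Wuthrich 6.1 ×2, GZK, modularity and Greenberg–Stevens (tree: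
  `X11a.mazurMainConjectureAt_of_missingLowerBoundAt_heightFree` one way, the five-fact door the other) — the weakest child a line can
  display; r16's Greenberg-μ child is strictly stronger (`μ^an = 0` is not a consequence of `BSD(E,p)`).
READING.  A printed (ram)-free
multiplicative main conjecture (Skinner 2016 Thm. A is printed under (irr)+(ram); X11a has no (ram) prime) would close the r17 child by
instantiation; a proof of Greenberg's Conj. 1.11 closes it through §2.  Nothing here is in print; nothing is asserted.

References: [Skinner2016PacificMC] Thm. A, §3.2–3.3 (shape); [GreenbergLNM1716] §1 Conj. 1.11 (p. 61); [EmertonPollackWeston2006]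
Thm. 1, 3.1.1, 5.1.3, Cor. 5.1.4; [Wan2015] Thm. 4; [YanZhu2024MainConjNonCM] Thm. 4.9; [Wuthrich2014] Thm. 3, Cor. 19, Lemma 20;
[Kato2004Asterisque] Thm. 12.4, §17.13; [SteinWuthrich2013] Thm. 6.1; [Mazur1978] Cor. 4.1; [MazurTateTeitelbaum1986Invent] §I.14;
[GreenbergStevens1993] Thm. (0.3); [Fisher2012Hessian] Thm. 13.2; [Miller2011LMS] Def. 1.1; cell files `Cruxes/X11aLowerHalf/Lines/birth.lean`
(r16), `LEAD-g6-VERDICT.md`, `Theorems/PrintX11aLowerHalfOfChildrenMuFive.lean` (p652061), `Theorems/PrintX11aLowerHalfThreeMazurCore.lean` (p646859).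
-/

set_option autoImplicit false
set_option linter.dupNamespace false -- the directory name repeats the summit name (sibling precedent)

noncomputable section

open scoped Classical MatrixGroups ModularForm

open CongruenceSubgroup UpperHalfPlane WeierstrassCurve IsDedekindDomain Rat.HeightOneSpectrum
  Literature.NumberTheory.EllipticCurves
  Literature.NumberTheory.EllipticCurves.ModularForms
  Literature.NumberTheory.EllipticCurves.Rank1Residual
  Literature.NumberTheory.EllipticCurves.Rank1Residual.Typed
  Literature.NumberTheory.EllipticCurves.Wuthrich2014
  Literature.NumberTheory.EllipticCurves.SteinWuthrich2013
  Literature.NumberTheory.EllipticCurves.Greenberg1999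
  Literature.NumberTheory.EllipticCurves.Kato2004
  Literature.NumberTheory.EllipticCurves.GreenbergVatsal2000
  Literature.NumberTheory.EllipticCurves.EmertonPollackWeston2006
  Literature.NumberTheory.EllipticCurves.SkinnerUrban2014
  Literature.NumberTheory.EllipticCurves.BalakrishnanEtAl2019
  Literature.NumberTheory.GaloisRepresentations
  Literature.NumberTheory.Automorphic
  Summit.BirchSwinnertonDyer.Rank1Residual
  Summit.BirchSwinnertonDyer.Rank1Residual.X11a
  Summit.BirchSwinnertonDyer.BirchSwinnertonDyer.Theorems.OddChain

/-! ### §1 Per pair: Mazur's statement at an X11a pair from member + rational equality + typed divisibility + certificate -/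

namespace Summit.BirchSwinnertonDyer.Rank1Residual.ClassX11a

variable {W : WeierstrassCurve ℚ} [W.IsElliptic] [W.IsGloballyMinimal] {p : ℕ} [Fact p.Prime]

/-- **MAZUR'S STATEMENT at an X11a pair, ANY odd `p`, EITHER image, from: the typed divisibility `X11b.MultDivisibilityAt W p`
(Kato's side — A32 under `p`-adic surjectivity, or the `_contra` packages at non-surjective image), the certificate `μ^an(E,p) = 0`
(`hμ`), ONE good-ordinary member `(g, ι)` of `H(E[p])` carrying the rational cyclotomic equality (`hRat`), and named facts** (EPW
3.1.1 ∕ Thm. 1 ∕ 5.1.3 at an odd prime, Deligne–Serre 6.1, Hida 3.26, modularity for the Manin-constant datum, Greenberg–Stevens at the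
pair): chain ⟹ `X11a.InvariantsMatchAt W p` (`OddChain.invariantsMatchAt_of_member_of_ratEq_of_multDivisibilityAt_odd`) ⟹ Mazur's statement
(`NonSurjChain.mazurMainConjectureAt_of_invariantsMatchAt_of_multDivisibilityAt`).  = the first two steps of the tree door
`ClassX11a.missingLowerBoundAt_of_member_of_ratEq_of_multDivisibilityAt`, stopped at the hinge.  PER PAIR; CONDITIONAL; closes nothing
class-wide. [cite: EmertonPollackWeston2006, Thm. 3.1.1, Thm. 1, Thm. 5.1.3] [cite: GreenbergStevens1993, Thm. (0.3) (p. 407)]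
[cite: MazurTateTeitelbaum1986Invent, §I.14 (shape only)] [cite: Wan2015, Thm. 4 (p. 4) (shape of hRat only)] -/
theorem mazurMainConjectureAt_of_member_of_ratEq_of_multDivisibilityAt
    (hNf : exists_isNewformOf)
    (h311 : thm311_cotorsion_weightK_member_ofLevel_odd) (hT1a : thm1_muAlg_of_weightK_member_ofLevel_odd)
    (hT1b : thm513_transfer_from_weightK_member_of_bdd_ofLevel_odd)
    (h61 : DeligneSerre1974.thm61_exists_adicGaloisRep) (h326 : Hida2000_thm326_ordinary)
    (hGS : greenberg_stevens (W := W) (p := p))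
    (hX : ClassX11a W p) (hdiv : X11b.MultDivisibilityAt W p) (hμ : X11a.MuAnZeroAt W p)
    {M : ℕ} [NeZero M] (hpM : ¬ p ∣ M) {k : ℤ} (g : CuspForm (Gamma0 M) k)
    (ι : coeffField g →+* PadicAlgCl p) (hmem : IsOrdinaryMemberOfLevel W p g ι) (hRat : RatEqAtMember p g ι) :
    X2.MazurMainConjectureAt W p := by
  have hmod : hasEntireLFunction_rat := hasEntireLFunction_rat_of_exists_isNewformOf hNf
  have hpar : nonempty_modularParametrizationData :=
    nonempty_modularParametrizationData_of_exists_isNewformOf hNf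
      IsNewformOf.exists_maninConstant_ne_zero_holds
  have hinv : InvariantsMatchAt W p :=
    invariantsMatchAt_of_member_of_ratEq_of_multDivisibilityAt_odd W p h311 hT1a hT1b h61 h326 hpar
      hX.ne_two hX.mult hX.irr hdiv hμ hpM g ι hmem hRat
  exact Summit.BirchSwinnertonDyer.BirchSwinnertonDyer.Theorems.NonSurjChain.mazurMainConjectureAt_of_invariantsMatchAt_of_multDivisibilityAt
    hmod W p hGS hdiv
    hX.analyticRank_eq_zero hinv

/-- **MAZUR'S STATEMENT at a DEEP X11a pair with `p ≥ 5`, either image, from the certificate `μ^an(E,p) = 0` and named facts**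
(the per-pair form of §2): X. Wan's Thm. 4 supplies the member with the rational equality (`OddChain.memberRatEqAt_of_wan_of_five_le`),
Serre + Kato–Wuthrich A32 the typed divisibility at surjective image, Kato 12.4 + §17.13 `_contra` ×3 + Mazur 4.1 at non-surjective
image.  PER PAIR; CONDITIONAL; closes nothing class-wide. [cite: Wan2015, Thm. 4 (pp. 4–5)] [cite: Wuthrich2014, Thm. 3 (p. 382), Cor. 19 (p. 399)]
[cite: Kato2004Asterisque, Thm. 12.4 (p. 221), §17.13 (pp. 279–280)] [cite: Mazur1978, Cor. 4.1] [cite: EmertonPollackWeston2006, Thm. 5.1.3] -/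
theorem mazurMainConjectureAt_of_muAnZeroAt_of_five_le_of_facts
    (hNf : exists_isNewformOf)
    (h311 : thm311_cotorsion_weightK_member_ofLevel_odd) (hT1a : thm1_muAlg_of_weightK_member_ofLevel_odd)
    (hT2 : Wan2015.thm4_rational_weightK_member_of_bdd_ofLevel_irred)
    (hT1b : thm513_transfer_from_weightK_member_of_bdd_ofLevel_odd)
    (h61 : DeligneSerre1974.thm61_exists_adicGaloisRep) (h326 : Hida2000_thm326_ordinary)
    (hKato : kato_charIdeal_dvd_multiplicative_of_surjective)
    (h12 : Kato2004.thm12_4)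
    (hns' : Kato2004.exists_multDivisibilityInputs_nonsplit_contra)
    (hsp' : Kato2004.exists_multDivisibilityInputs_split_contra)
    (hfine' : Kato2004.exists_multDivisibilityInputs_fine_contra)
    (hMz : mazur_not_dvd_maninConstant_of_odd)
    (hGS : greenberg_stevens (W := W) (p := p))
    (hX : ClassX11a W p) (hp5 : 5 ≤ p) (hμ : X11a.MuAnZeroAt W p) :
    X2.MazurMainConjectureAt W p := by
  obtain ⟨M, _, hpM, k, g, ι, hmem, hRat⟩ := memberRatEqAt_of_wan_of_five_le W p hNf hT2 hp5 hX.mult hX.irr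
  by_cases hsurj : Surj W p
  · have hsurj' : ∀ n : ℕ, W.HasSurjectiveModNGaloisRep (p ^ n : ℕ) :=
      kato_charIdeal_dvd_multiplicative_of_surjective.surjective_pow_of_five_le W p hp5 hsurj
    exact hX.mazurMainConjectureAt_of_member_of_ratEq_of_multDivisibilityAt hNf h311 hT1a hT1b h61 h326 hGS
      (multDivisibilityAt_of_kato_of_surjective_pow hKato hX.ne_two hX.mult hsurj') hμ hpM g ι hmem hRat
  · exact hX.mazurMainConjectureAt_of_member_of_ratEq_of_multDivisibilityAt hNf h311 hT1a hT1b h61 h326 hGS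
      (X11b.multDivisibilityAt_of_katoFacts_of_muAnZeroAt_contra_of_mazur Kato2004.nonempty_iwasawaH1Data_holds h12
        hNf hns' hsp' hfine' hMz W p hX.ne_two hX.mult hX.irr hsurj hμ)
      hμ hpM g ι hmem hRat

end Summit.BirchSwinnertonDyer.Rank1Residual.ClassX11a

namespace Summit.BirchSwinnertonDyer.BirchSwinnertonDyer.Theorems.Birth

/-! ### §2 Monotonicity: r16's `p ≥ 5` text (Greenberg μ) ⟹ the r17 text (Mazur), modulo facts r16 displays -/

/-- **MONOTONICITY of the r17 re-cut**: r16's registered `p ≥ 5` child `stub_muAnDeepFive` (`hμ5`, verbatim) + the shared nine (`h9`,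
verbatim U3's text) + SEVEN of r16's eight chain facts (`h7L`: EPW 3.1.1 ∕ Thm. 1 alg ∕ Wan Thm. 4 ∕ EPW 5.1.3 ∕ Deligne–Serre 6.1 ∕
Hida 3.26 ∕ Kato–Wuthrich A32 — r16's `stub_chainFactsLower` minus GZK, same order) ⟹ the r17 `p ≥ 5` child: Mazur's cyclotomic
main conjecture at EVERY deep X11a pair with `p ≥ 5` (§1 at each pair).  So every proof of the r16 text closes the r17 text modulo
facts r16 already displayed: the re-cut loses no road.  CONDITIONAL; closes nothing by itself.
[cite: GreenbergLNM1716, §1 Conj. 1.11 (p. 61)] [cite: Wan2015, Thm. 4 (pp. 4–5)] [cite: EmertonPollackWeston2006, Thm. 3.1.1, Thm. 1, Thm. 5.1.3]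
[cite: Skinner2016PacificMC, Thm. A (shape only; printed under (ram))] -/
theorem mazurMCAtDeepFive_of_muAnDeepFive_of_facts
    (h9 : thm61_splitMultiplicative ∧ thm61_nonsplitMultiplicative ∧
      (∀ (W : WeierstrassCurve ℚ) [W.IsElliptic] [W.IsGloballyMinimal] (p : ℕ) [Fact p.Prime],
        p ≠ 2 → greenberg_stevens (W := W) (p := p)) ∧
      Kato2004.thm12_4 ∧ exists_isNewformOf ∧
      Kato2004.exists_multDivisibilityInputs_nonsplit_contra ∧
      Kato2004.exists_multDivisibilityInputs_split_contra ∧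
      Kato2004.exists_multDivisibilityInputs_fine_contra ∧ mazur_not_dvd_maninConstant_of_odd)
    (h7L : thm311_cotorsion_weightK_member_ofLevel_odd ∧ thm1_muAlg_of_weightK_member_ofLevel_odd ∧
      Wan2015.thm4_rational_weightK_member_of_bdd_ofLevel_irred ∧
      thm513_transfer_from_weightK_member_of_bdd_ofLevel_odd ∧
      DeligneSerre1974.thm61_exists_adicGaloisRep ∧ Hida2000_thm326_ordinary ∧
      kato_charIdeal_dvd_multiplicative_of_surjective)
    (hμ5 : ∀ (W : WeierstrassCurve ℚ) [W.IsElliptic] [W.IsGloballyMinimal] (p : ℕ) [Fact p.Prime],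
      ClassX11a W p → 5 ≤ p → ¬ X11a.ShaAnUnit W p → X11a.MuAnZeroAt W p) :
    ∀ (W : WeierstrassCurve ℚ) [W.IsElliptic] [W.IsGloballyMinimal] (p : ℕ) [Fact p.Prime],
      ClassX11a W p → 5 ≤ p → ¬ X11a.ShaAnUnit W p → X2.MazurMainConjectureAt W p := by
  obtain ⟨-, -, hGS, h12, hNf, hns', hsp', hfine', hMz⟩ := h9
  obtain ⟨h311, hT1a, hT2, hT1b, h61, h326, hKato⟩ := h7L
  intro W _ _ p _ hX hp5 hu
  exact hX.mazurMainConjectureAt_of_muAnZeroAt_of_five_le_of_facts hNf h311 hT1a hT2 hT1b h61 h326 hKato h12 hns'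
    hsp' hfine' hMz (hGS W p hX.ne_two) hp5 (hμ5 W p hX hp5 hu)

/-- **r16's chain-EIGHT ⟹ the SEVEN facts of the monotonicity theorem** (drop GZK; projection). [cite: EmertonPollackWeston2006, Thm. 5.1.3]
[cite: Wan2015, Thm. 4 (pp. 4–5)] -/
theorem chainSeven_of_chainEight
    (h8L : thm311_cotorsion_weightK_member_ofLevel_odd ∧ thm1_muAlg_of_weightK_member_ofLevel_odd ∧
      Wan2015.thm4_rational_weightK_member_of_bdd_ofLevel_irred ∧
      thm513_transfer_from_weightK_member_of_bdd_ofLevel_odd ∧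
      DeligneSerre1974.thm61_exists_adicGaloisRep ∧ Hida2000_thm326_ordinary ∧
      kato_charIdeal_dvd_multiplicative_of_surjective ∧
      rank_eq_analyticRank_of_analyticRank_le_one) :
    thm311_cotorsion_weightK_member_ofLevel_odd ∧ thm1_muAlg_of_weightK_member_ofLevel_odd ∧
      Wan2015.thm4_rational_weightK_member_of_bdd_ofLevel_irred ∧
      thm513_transfer_from_weightK_member_of_bdd_ofLevel_odd ∧
      DeligneSerre1974.thm61_exists_adicGaloisRep ∧ Hida2000_thm326_ordinary ∧
      kato_charIdeal_dvd_multiplicative_of_surjective :=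
  ⟨h8L.1, h8L.2.1, h8L.2.2.1, h8L.2.2.2.1, h8L.2.2.2.2.1, h8L.2.2.2.2.2.1, h8L.2.2.2.2.2.2.1⟩

/-- **r16's chain-EIGHT ⟹ r17's chain-TWO** (Kato–Wuthrich A32, GZK; projection). [cite: Wuthrich2014, Thm. 3 (p. 382), Cor. 19 (p. 399)]
[cite: GrossZagier1986, I.(7.3) (shape only)] -/
theorem chainTwo_of_chainEight
    (h8L : thm311_cotorsion_weightK_member_ofLevel_odd ∧ thm1_muAlg_of_weightK_member_ofLevel_odd ∧
      Wan2015.thm4_rational_weightK_member_of_bdd_ofLevel_irred ∧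
      thm513_transfer_from_weightK_member_of_bdd_ofLevel_odd ∧
      DeligneSerre1974.thm61_exists_adicGaloisRep ∧ Hida2000_thm326_ordinary ∧
      kato_charIdeal_dvd_multiplicative_of_surjective ∧
      rank_eq_analyticRank_of_analyticRank_le_one) :
    kato_charIdeal_dvd_multiplicative_of_surjective ∧ rank_eq_analyticRank_of_analyticRank_le_one :=
  ⟨h8L.2.2.2.2.2.2.1, h8L.2.2.2.2.2.2.2⟩

/-! ### §3 Candidate r17: FIVE children, BOTH research children in Mazur currency -/

/-- **Crux L BY NAME from FIVE children — candidate r17**: the shared nine `h9` (U3's text, verbatim), the TWO chain facts `h2L`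
(Kato–Wuthrich A32, GZK — consumed on the finite-flat `p = 3` locus, GZK also by the five-fact door), the three partner facts `hQ3`
(EPW Cor. 5.1.4, Yan–Zhu Thm. 4.9, EPW Thm. 1 alg; finite-flat `p = 3` locus only), and the two research children in MAZUR currency:
`hMC5 : ∀ W p, ClassX11a W p → 5 ≤ p → ¬ X11a.ShaAnUnit W p → X2.MazurMainConjectureAt W p` (NEW text: Mazur's cyclotomic main
conjecture at every deep X11a pair with `p ≥ 5`, both images; OPEN — Skinner 2016 Thm. A is printed under (ram), which X11a lacks) and
r15's `hMC3` (the same statement on the très-ramifié deep locus at `3`; OPEN).  Unit pairs free; `p ≥ 5` deep ⟶ the FIVE-fact door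
`ClassX11a.missingLowerBoundAt_of_mazurMainConjectureAt_of_facts` (modularity, Stein–Wuthrich 6.1 ×2, GZK, Greenberg–Stevens at the
pair — NO chain fact); `p = 3` deep ⟶ `ThreePartner.lowerThreeDeep_of_partnerFF_of_mazurTR_of_facts` exactly as in r15∕r16.  Skeleton
use: `X11aLowerHalf_of := x11aLowerHalf_erratumRoadFive_of_children_r17 stub_nineFactsOddGS stub_katoGZKFactsLower
stub_threePartnerFactsLower stub_mazurMCAtDeepFive stub_mazurMCAtTresRamifieThree`.  Distinct named published facts on such a line: 14.
CONDITIONAL; closes nothing; BSD is not proved. [cite: Skinner2016PacificMC, Thm. A (shape only; printed under (irr)+(ram))]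
[cite: MazurTateTeitelbaum1986Invent, §I.14 (shape only)] [cite: SteinWuthrich2013, Thm. 6.1 (p. 20)]
[cite: EmertonPollackWeston2006, Thm. 1, Cor. 5.1.4] [cite: YanZhu2024MainConjNonCM, Thm. 4.9] [cite: Fisher2012Hessian, Thm. 13.2 (n = 3)]
[cite: Miller2011LMS, Def. 1.1 (arXiv:1010.2431 p. 3)] -/
theorem x11aLowerHalf_of_children_r17
    (h9 : thm61_splitMultiplicative ∧ thm61_nonsplitMultiplicative ∧
      (∀ (W : WeierstrassCurve ℚ) [W.IsElliptic] [W.IsGloballyMinimal] (p : ℕ) [Fact p.Prime],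
        p ≠ 2 → greenberg_stevens (W := W) (p := p)) ∧
      Kato2004.thm12_4 ∧ exists_isNewformOf ∧
      Kato2004.exists_multDivisibilityInputs_nonsplit_contra ∧
      Kato2004.exists_multDivisibilityInputs_split_contra ∧
      Kato2004.exists_multDivisibilityInputs_fine_contra ∧ mazur_not_dvd_maninConstant_of_odd)
    (h2L : kato_charIdeal_dvd_multiplicative_of_surjective ∧ rank_eq_analyticRank_of_analyticRank_le_one)
    (hQ3 : cor514_transfer_of_goodOrdinary_odd ∧ YanZhu2026.thm49_charIdeal_eq_padicLFunction ∧
      thm1_muAlg_transfer_goodOrdinary_of_mult_odd)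
    (hMC5 : ∀ (W : WeierstrassCurve ℚ) [W.IsElliptic] [W.IsGloballyMinimal] (p : ℕ) [Fact p.Prime],
      ClassX11a W p → 5 ≤ p → ¬ X11a.ShaAnUnit W p → X2.MazurMainConjectureAt W p)
    (hMC3 : ∀ (W : WeierstrassCurve ℚ) [W.IsElliptic] [W.IsGloballyMinimal] (p : ℕ) [Fact p.Prime],
      ClassX11a W p → p = 3 → ¬ X11a.ShaAnUnit W p → ¬ p ∣ padicValInt p W.minimalDiscriminantInt →
      X2.MazurMainConjectureAt W p) :
    Summit.BirchSwinnertonDyer.BirchSwinnertonDyer.Theses.PrintX11a.X11aLowerHalf := by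
  obtain ⟨hJs, hJn, hGS, h12, hNf, hns', hsp', hfine', hMz⟩ := h9
  obtain ⟨hKato, hGZK⟩ := h2L
  obtain ⟨hEPW, hYZ, hTa⟩ := hQ3
  intro W _ _ p hpF hX
  by_cases hu : X11a.ShaAnUnit W p
  · exact x11a_missingLowerBoundAt_of_shaAnUnit hu
  by_cases hp3 : p = 3
  · exact ThreePartner.lowerThreeDeep_of_partnerFF_of_mazurTR_of_facts hNf hKato h12 hns' hsp' hfine' hMz hJs hJn
      hGZK hGS hEPW hYZ hTa hMC3 W p hX hp3 hu
  · -- `p ≥ 5`, both images: Mazur's statement at the pair (the residual) through the five-fact door — no chain fact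
    have hp5 : 5 ≤ p := (Fact.out : p.Prime).five_le_of_ne_two_of_ne_three hX.ne_two hp3
    exact hX.missingLowerBoundAt_of_mazurMainConjectureAt_of_facts hNf hJs hJn hGZK (hGS W p hX.ne_two)
      (hMC5 W p hX hp5 hu)

/-- The `ErratumRoadFive` spelling of the five-children composition r17 (one statement under two route names, `Iff.rfl`) — usable as
the skeleton's `X11aLowerHalf_of`. [cite: Miller2011LMS, Def. 1.1 (arXiv:1010.2431 p. 3)]
[cite: Skinner2016PacificMC, Thm. A (shape only)] -/
theorem x11aLowerHalf_erratumRoadFive_of_children_r17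
    (h9 : thm61_splitMultiplicative ∧ thm61_nonsplitMultiplicative ∧
      (∀ (W : WeierstrassCurve ℚ) [W.IsElliptic] [W.IsGloballyMinimal] (p : ℕ) [Fact p.Prime],
        p ≠ 2 → greenberg_stevens (W := W) (p := p)) ∧
      Kato2004.thm12_4 ∧ exists_isNewformOf ∧
      Kato2004.exists_multDivisibilityInputs_nonsplit_contra ∧
      Kato2004.exists_multDivisibilityInputs_split_contra ∧
      Kato2004.exists_multDivisibilityInputs_fine_contra ∧ mazur_not_dvd_maninConstant_of_odd)
    (h2L : kato_charIdeal_dvd_multiplicative_of_surjective ∧ rank_eq_analyticRank_of_analyticRank_le_one)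
    (hQ3 : cor514_transfer_of_goodOrdinary_odd ∧ YanZhu2026.thm49_charIdeal_eq_padicLFunction ∧
      thm1_muAlg_transfer_goodOrdinary_of_mult_odd)
    (hMC5 : ∀ (W : WeierstrassCurve ℚ) [W.IsElliptic] [W.IsGloballyMinimal] (p : ℕ) [Fact p.Prime],
      ClassX11a W p → 5 ≤ p → ¬ X11a.ShaAnUnit W p → X2.MazurMainConjectureAt W p)
    (hMC3 : ∀ (W : WeierstrassCurve ℚ) [W.IsElliptic] [W.IsGloballyMinimal] (p : ℕ) [Fact p.Prime],
      ClassX11a W p → p = 3 → ¬ X11a.ShaAnUnit W p → ¬ p ∣ padicValInt p W.minimalDiscriminantInt →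
      X2.MazurMainConjectureAt W p) :
    Summit.BirchSwinnertonDyer.BirchSwinnertonDyer.Theses.ErratumRoadFive.X11aLowerHalf :=
  x11aLowerHalf_of_children_r17 h9 h2L hQ3 hMC5 hMC3

/-! ### §4 Cross-check (not re-landed): r16's five binders give the crux THROUGH r17 —
`x11aLowerHalf_of_children_r17 h9 (chainTwo_of_chainEight h8L) hQ3 (mazurMCAtDeepFive_of_muAnDeepFive_of_facts h9
(chainSeven_of_chainEight h8L) hμ5) hMC3 : Theses.PrintX11a.X11aLowerHalf` elaborates (lead g7 folder check, axioms
propext ∕ Classical.choice ∕ Quot.sound); its statement is p652061's `x11aLowerHalf_of_children_r16`, so the gate's dedup keeps it out of the tree. -/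

/-! ### §5 Why the r17 child is the WEAKEST possible on the surjective locus: there it is EQUIVALENT to the crux, modulo six facts -/

/-- **The CRUX ITSELF ⟹ the r17 `p ≥ 5` child on the SURJECTIVE deep locus** (converse direction; modulo Kato–Wuthrich A32,
Stein–Wuthrich 6.1 ×2, GZK, modularity and Greenberg–Stevens at odd primes): at an X11a pair with `p ≥ 5` and `ρ̄_{E,p}` onto, the lower
half `ord_p #Ш_an ≤ ord_p #Ш` forces Mazur's main conjecture at the pair — the tree's rank-`0` converse
`X11a.mazurMainConjectureAt_of_missingLowerBoundAt_heightFree` (Kato's divisibility is an equality once the leading terms match).  So on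
that locus the r17 child asks for NOTHING beyond the crux; r16's Greenberg-`μ` child did.  CONDITIONAL; closes nothing.
[cite: GreenbergLNM1716, §4 (PDF pp. 112–113)] [cite: Wuthrich2014, Thm. 3 (p. 382) and Cor. 19 (p. 399)] [cite: Miller2011LMS, Def. 1.1] -/
theorem mazurMCAtSurjFive_of_x11aLowerHalf_of_facts
    (hNf : exists_isNewformOf) (hKato : kato_charIdeal_dvd_multiplicative_of_surjective)
    (hJs : thm61_splitMultiplicative) (hJn : thm61_nonsplitMultiplicative)
    (hGZK : rank_eq_analyticRank_of_analyticRank_le_one)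
    (hGS : ∀ (W : WeierstrassCurve ℚ) [W.IsElliptic] [W.IsGloballyMinimal] (p : ℕ) [Fact p.Prime],
      p ≠ 2 → greenberg_stevens (W := W) (p := p))
    (hL : Summit.BirchSwinnertonDyer.BirchSwinnertonDyer.Theses.PrintX11a.X11aLowerHalf) :
    ∀ (W : WeierstrassCurve ℚ) [W.IsElliptic] [W.IsGloballyMinimal] (p : ℕ) [Fact p.Prime],
      ClassX11a W p → 5 ≤ p → Surj W p → X2.MazurMainConjectureAt W p := by
  intro W _ _ p _ hX hp5 hs
  have hmod : hasEntireLFunction_rat := hasEntireLFunction_rat_of_exists_isNewformOf hNf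
  exact X11a.mazurMainConjectureAt_of_missingLowerBoundAt_heightFree hKato hJs hJn hGZK hmod W p (hGS W p hX.ne_two)
    hp5 hX.mult hs hX.analyticRank_eq_zero (hL W p hX)

/-- **On the surjective locus at `p ≥ 5`, «Mazur's main conjecture at every X11a pair» ⟺ «the lower half at every X11a pair»,
modulo the six displayed facts** (§5's converse one way, the five-fact door `ClassX11a.missingLowerBoundAt_of_mazurMainConjectureAt_of_facts`
the other).  The r17 child restricted to surjective image is therefore EXACTLY the crux restricted there (unit pairs included: on them
both sides hold — the lower half outright, Mazur's statement by the converse).  CONDITIONAL on the facts; asserts nothing about any curve.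
[cite: GreenbergLNM1716, §4 (PDF pp. 112–113)] [cite: SteinWuthrich2013, Thm. 6.1 (p. 20)] [cite: Miller2011LMS, Def. 1.1] -/
theorem mazurMCAtSurjFive_iff_lowerSurjFive_of_facts
    (hNf : exists_isNewformOf) (hKato : kato_charIdeal_dvd_multiplicative_of_surjective)
    (hJs : thm61_splitMultiplicative) (hJn : thm61_nonsplitMultiplicative)
    (hGZK : rank_eq_analyticRank_of_analyticRank_le_one)
    (hGS : ∀ (W : WeierstrassCurve ℚ) [W.IsElliptic] [W.IsGloballyMinimal] (p : ℕ) [Fact p.Prime],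
      p ≠ 2 → greenberg_stevens (W := W) (p := p)) :
    (∀ (W : WeierstrassCurve ℚ) [W.IsElliptic] [W.IsGloballyMinimal] (p : ℕ) [Fact p.Prime],
        ClassX11a W p → 5 ≤ p → Surj W p → X2.MazurMainConjectureAt W p) ↔
      ∀ (W : WeierstrassCurve ℚ) [W.IsElliptic] [W.IsGloballyMinimal] (p : ℕ) [Fact p.Prime],
        ClassX11a W p → 5 ≤ p → Surj W p → MissingLowerBoundAt W p := by
  have hmod : hasEntireLFunction_rat := hasEntireLFunction_rat_of_exists_isNewformOf hNf
  constructor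
  · intro h W _ _ p _ hX hp5 hs
    exact hX.missingLowerBoundAt_of_mazurMainConjectureAt_of_facts hNf hJs hJn hGZK (hGS W p hX.ne_two) (h W p hX hp5 hs)
  · intro h W _ _ p _ hX hp5 hs
    exact X11a.mazurMainConjectureAt_of_missingLowerBoundAt_heightFree hKato hJs hJn hGZK hmod W p (hGS W p hX.ne_two)
      hp5 hX.mult hs hX.analyticRank_eq_zero (h W p hX hp5 hs)

end Summit.BirchSwinnertonDyer.BirchSwinnertonDyer.Theorems.Birth

end
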